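import Mathlib
import Summits.ResolutionOfSingularities.ResolutionOfSingularities.Theorems.WildQuotientsWildQuotientResolutionCyclicTransfer
import Summits.ResolutionOfSingularities.ResolutionOfSingularities.Theorems.WildQuotientsWildQuotientResolutionAffineQuotientData
import Summits.ResolutionOfSingularities.ResolutionOfSingularities.Theorems.WildQuotientsWildQuotientResolutionAffineQuotientEtale
import Summits.ResolutionOfSingularities.ResolutionOfSingularities.Theorems.WildQuotientsWildQuotientResolutionLinearSmallBlocksAlgebra
import Summits.ResolutionOfSingularities.ResolutionOfSingularities.Theorems.WildQuotientsWildQuotientResolutionFixedPointsGraded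
import Summits.ResolutionOfSingularities.ResolutionOfSingularities.Theorems.WildQuotientsWildQuotientResolutionJordanThreeOrder
import HarnessLib

/-!
# Rung V3: `𝔸ⁿ/⟨J₃ ⊕ 1^{n-3}⟩` in characteristic `3` has a resolution GIVEN a terminal model

(crux stmt-ResolutionOfSingularities-15640 `WildQuotients.WildQuotientResolution`, line `Sketch`,
sector `|G| = p`; rung V3 of `L/w45c/CHAIN.md` v4, candidate `v3_hasResolution_of_model` of
`L/w45c/W45cPlanSignaturesV4.lean` (planner res-L1-w45c-plan-1) with the planning abbreviations
`SpecActionLaw` / `IsTerminalModel` unfolded exactly as in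
`LinearSmallBlocks.linearSmallBlocks_hasResolution_of_model`; [OURS · L1 W4.5c] — NOT a statement of
any manuscript; replaces the role of no printed item.)

For the `J₃` datum `σ x_b = x_b + x_a`, `σ x_c = x_c + x_b`, identity on every other coordinate
(`a, b, c` distinct) over a field of characteristic `3`:
* `v3_hasResolution_of_model` — `Spec k[x]^σ` has a resolution AS SOON AS every action
  `ρ g = Spec (g⁻¹)` of `⟨σ⟩` on `𝔸ⁿ` admits a Király–Lütkebohmert terminal model (`hmodel`, the
  seven model-side hypotheses of `CyclicTransfer.cyclicDivisorialTransfer_of_card`): affine quotient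
  data (`AffineQuotient.*`), `|⟨σ⟩| = 3` (`JordanThree.card_zpowers_charThree`), generic étaleness
  over `D(x_a)` (`AffineQuotient.exists_dense_etale_morphismRestrict` with
  `LinearSmallBlocks.X_mem_augIdeal_of_transvection` at the transvection pair `(a, b)`),
  `dim = n > 0`, fed to `CyclicTransfer.cyclicDivisorialTransfer_of_card`.
The intended model is the plain three-step tower of CHAIN v4 §B (`v3_terminalModel_charThree`,
lead-1); the final `v3_hasResolution_charThree` is then one line.
-/

-- single-problem summit: the doubled namespace component `ResolutionOfSingularities` is forced
set_option linter.dupNamespace false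

noncomputable section

open CategoryTheory AlgebraicGeometry TopologicalSpace MvPolynomial
open scoped Pointwise
open Literature.AlgebraicGeometry.Resolution

namespace Summit.ResolutionOfSingularities.ResolutionOfSingularities.Theorems.WildQuotientResolution.JordanThree

/-- **Rung V3 modulo its terminal model** (`v3_hasResolution_of_model` of `W45cPlanSignaturesV4.lean`,
abbreviations unfolded): for the `J₃` datum in characteristic `3` and EVERY action
`ρ : ⟨σ⟩ →* Aut 𝔸ⁿ` with `ρ g = Spec (g⁻¹)` admitting a Király–Lütkebohmert terminal model
(`hmodel`: the seven model-side hypotheses of `CyclicTransfer.cyclicDivisorialTransfer_of_card`), the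
quotient `Spec k[x]^σ` has a resolution of singularities. [OURS · L1 W4.5c]
[cite: KiralyLutkebohmert2013, Thm 2] [cite: SGA1, Exp. V, §1–2] -/
theorem v3_hasResolution_of_model (k : Type) [Field k] [CharP k 3] (n : ℕ)
    (σ : MvPolynomial (Fin n) k ≃ₐ[k] MvPolynomial (Fin n) k) (a b c : Fin n)
    (hab : a ≠ b) (hbc : b ≠ c) (hac : a ≠ c)
    (hb : σ (X b) = X b + X a) (hc : σ (X c) = X c + X b)
    (hσ : ∀ i, i ≠ b → i ≠ c → σ (X i) = X i)
    (hmodel : ∀ ρ : ↥(Subgroup.zpowers σ) →* Aut (Spec (CommRingCat.of (MvPolynomial (Fin n) k))),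
      (∀ g : ↥(Subgroup.zpowers σ), (ρ g).hom = Spec.map (CommRingCat.ofHom
        ((MulSemiringAction.toRingEquiv (↥(Subgroup.zpowers σ)) (MvPolynomial (Fin n) k) g⁻¹ :
          MvPolynomial (Fin n) k ≃+* MvPolynomial (Fin n) k) :
            MvPolynomial (Fin n) k →+* MvPolynomial (Fin n) k))) →
      ∃ (V : Scheme.{0}) (π : V ⟶ Spec (CommRingCat.of (MvPolynomial (Fin n) k)))
        (ρV : ↥(Subgroup.zpowers σ) →* Aut V), IsProper π ∧ IsBirational π ∧
        IsIntegral V ∧ Scheme.IsRegular V ∧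
        (∀ g : ↥(Subgroup.zpowers σ), (ρV g).hom ≫ π = π ≫ (ρ g).hom) ∧
        (∀ v : V, ∃ W : V.Opens, IsAffineOpen W ∧ v ∈ W ∧
          ∀ g : ↥(Subgroup.zpowers σ), (ρV g).hom ⁻¹ᵁ W = W) ∧
        (∀ (g : ↥(Subgroup.zpowers σ)) (v : V) (hv : (ρV g).hom.base v = v),
          (Ideal.span (Set.range fun s : V.presheaf.stalk v =>
            (V.presheaf.stalkSpecializes (specializes_of_eq hv) ≫ (ρV g).hom.stalkMap v).hom s -
              s)).IsPrincipal)) :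
    Scheme.HasResolution
      (Spec (.of (FixedPoints.subalgebra k (MvPolynomial (Fin n) k) (Subgroup.zpowers σ)))) := by
  classical
  haveI : Fact (Nat.Prime 3) := ⟨Nat.prime_three⟩
  have hσp : σ ^ 3 = 1 := (v3_order_charThree k n σ a b c hab hbc hac hb hc hσ).1
  have hcard : Nat.card (Subgroup.zpowers σ) = 3 :=
    card_zpowers_charThree k n σ a b c hab hac hb hc hσ
  have ha : σ (X a) = X a := hσ a hab hac
  have hn : 0 < n := Fin.pos a
  -- the rings: `S = k[x]`, `G = ⟨σ⟩`, `A = S^G`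
  let S : Type := MvPolynomial (Fin n) k
  let G : Type := ↥(Subgroup.zpowers σ)
  haveI : Finite G := Nat.finite_of_card_ne_zero (hcard ▸ (by decide : (3 : ℕ) ≠ 0))
  let A : Subalgebra k S := FixedPoints.subalgebra k S G
  -- the action on `𝔸ⁿ` and its terminal model
  obtain ⟨ρ, hρ⟩ := AffineQuotient.exists_specAction S G
  obtain ⟨V, π, ρV, hVprop, hbir, hVint, hVreg, hequiv, hcov, hdiv⟩ := hmodel ρ hρ
  haveI := hVprop
  haveI := hVint
  -- the quotient data
  let fk : Spec (.of A) ⟶ Spec (.of k) := Spec.map (CommRingCat.ofHom (algebraMap k A))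
  let q : Spec (.of S) ⟶ Spec (.of A) := Spec.map (CommRingCat.ofHom (algebraMap A S))
  haveI : LocallyOfFiniteType fk := AffineQuotient.locallyOfFiniteType_specMap_fixedPoints k
  haveI : IsFinite q := AffineQuotient.isFinite_specMap_fixedPoints k
  have hsurj : Function.Surjective q.base := AffineQuotient.surjective_specMap_fixedPoints k
  have hρq : ∀ g : G, (ρ g).hom ≫ q = q := AffineQuotient.specAction_comp k ρ hρ
  have horb : ∀ x y : Spec (CommRingCat.of S), q.base x = q.base y →
      ∃ g : G, (ρ g).hom.base x = y :=
    fun x y hxy => AffineQuotient.exists_specAction_base_eq k ρ hρ x y hxy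
  -- generically étale: over `D(x_a)` (the transvection pair `(a, b)`)
  have hXa : (X a : S) ∈ A := (TameTransfer.mem_fixedPoints_zpowers_iff_apply_eq σ (X a)).mpr ha
  have ht0 : (⟨X a, hXa⟩ : A) ≠ 0 := fun h =>
    MvPolynomial.X_ne_zero a (congrArg Subtype.val h : ((⟨X a, hXa⟩ : A) : S) = ((0 : A) : S))
  have hU : ∃ U : (Spec (.of A)).Opens, Dense (U : Set (Spec (.of A))) ∧ Etale (q ∣_ U) :=
    AffineQuotient.exists_dense_etale_morphismRestrict k (⟨X a, hXa⟩ : A) ht0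
      fun g hg => LinearSmallBlocks.X_mem_augIdeal_of_transvection k 3 Nat.prime_three σ a b ha hb
        hσp g hg
  -- `dim X₁ = dim 𝔸ⁿ = n > 0`
  have hdim : ¬ topologicalKrullDim (Spec (CommRingCat.of A)) ≤ 0 := by
    rw [AffineQuotient.topologicalKrullDim_spec_fixedPoints k,
      AffineQuotient.topologicalKrullDim_spec_mvPolynomial k n]
    have hn' : (0 : WithBot ℕ∞) < (n : WithBot ℕ∞) := by exact_mod_cast hn
    exact not_le.mpr hn'
  -- the transfer
  exact CyclicTransfer.cyclicDivisorialTransfer_of_card 3 Nat.prime_three k (Spec (.of S))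
    (Spec (.of A)) fk q G ρ hcard hdim hsurj hU hρq horb V π ρV hbir hVreg hequiv hcov hdiv

end Summit.ResolutionOfSingularities.ResolutionOfSingularities.Theorems.WildQuotientResolution.JordanThree

end
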